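import Summits.CriticalPhenomena.PercolationContinuityZ3.Theorems.Transplant.DiagramComparisonAmenable
import HarnessLib

/-!
# Hutchcroft's diagram comparison, second inequality: `A_p ≤ ∇_p²` on vertex-transitive graphs (Lemma 3.3 without operators)

Proof file (`--supports stmt-CriticalPhenomena-4575 --as helper`), lane `prim-bschramm`, seat `prim-bschramm-gen-1` gen 12 (GEN pen); item (c3) of lead g29's Q-DOOR-2, over
«DiagramComparisonAmenable» (`diagA`, `summandA`, window identities) and DEFS-A's `triangle`.  builds on p205010 (kernel theorem, internal audit signed; external expert
review pending) — nothing here uses p205010.  Def-free; no instance, no notation, no sorry; nothing about `θ(p_c)`.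

THE THEOREM: **`diagA_le_triangle_sq (htr : IsGraphTransitive G) (hconn : G.Connected) (v) (p) : diagA G v p ≤ (triangle G v p)^2`** for EVERY `p` (no growth
hypothesis needed here).  PROOF (Hutchcroft's Lemma 3.3 `T³(x,y) ≤ T³(o,o) = ∇`, finitely): on a window `B ∋ v`, `Σ_{q∈B⁴} summandA(v,q) = Σ_{y,z∈B} τ(v,y)τ(v,z)τ(z,y)·(T_B³)(v,y)`,
and `T_B³` is positive semidefinite (E4.3b `posSemidef_connMatrix`), so `(T_B³)(v,y) ≤ ((T_B³)(v,v) + (T_B³)(y,y))/2 ≤ ∇` (each diagonal entry is a partial sum of the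
triangle diagram at its own root, `= ∇_p(v)` by transitivity); the remaining double sum is a partial sum of `∇_p(v)`; finally `A = sup` of its window sums.
[cite: Hutchcroft2022Triangle, Prop. 1.7, Lemma 3.3] [cite: HeydenreichVanDerHofstad2017, §4.1]
-/

noncomputable section

namespace Summit.CriticalPhenomena.PercolationContinuityZ3.Theorems.Transplant

namespace Grigorchuk

namespace NcHaraSlade

open SimpleGraph Finset MeasureTheory Filter Literature.Probability.Percolation Literature.Barriers.CriticalPhenomena
open scoped ENNReal

variable {V : Type} [DecidableEq V] (G : SimpleGraph V) [G.LocallyFinite]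

/-! ## §1 A positive semidefinite matrix is dominated by its diagonal -/

omit [DecidableEq V] [G.LocallyFinite] in
/-- For a real positive semidefinite matrix, `M(x,y) ≤ (M(x,x) + M(y,y))/2` (test vector `e_x − e_y`). [folklore] -/
theorem posSemidef_apply_le_half {ι : Type} [Fintype ι] [DecidableEq ι] {M : Matrix ι ι ℝ} (hM : M.PosSemidef) (x y : ι) :
    M x y ≤ (M x x + M y y) / 2 := by
  have hsymm : M y x = M x y := by simpa using hM.1.apply x y
  have h := (Matrix.posSemidef_iff_dotProduct_mulVec.1 hM).2 (Pi.single x 1 - Pi.single y 1)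
  simp only [star_trivial, Matrix.mulVec_sub, dotProduct_sub, sub_dotProduct, Matrix.mulVec_single_one, single_one_dotProduct,
    Matrix.col_apply] at h
  linarith

/-! ## §2 The triangle diagram: invariance and window bounds -/

omit [DecidableEq V] [G.LocallyFinite] in
/-- `∇_p(γ v) = ∇_p(v)`. [folklore] -/
theorem triangle_iso (γ : G ≃g G) (v : V) (p : unitInterval) : triangle G (γ v) p = triangle G v p := by
  unfold triangle
  rw [← γ.toEquiv.tsum_eq]
  refine tsum_congr fun x => ?_
  rw [← γ.toEquiv.tsum_eq]
  refine tsum_congr fun y => ?_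
  simp only [RelIso.coe_fn_toEquiv, conn_iso]

omit [DecidableEq V] [G.LocallyFinite] in
/-- A window's partial triangle sum is below the triangle diagram: `Σ_{u,w∈B} τ(x,u)τ(u,w)τ(w,x) ≤ ∇_p(x)` (as a real number, `∇_p(x) < ∞`). [folklore] -/
theorem sum_sum_conn_le_triangle (p : unitInterval) (B : Finset V) (x : V) (hfin : triangle G x p ≠ ⊤) :
    ∑ u ∈ B, ∑ w ∈ B, conn G p x u * conn G p u w * conn G p w x ≤ (triangle G x p).toReal := by
  rw [← ENNReal.ofReal_le_iff_le_toReal hfin, ENNReal.ofReal_sum_of_nonneg fun u _ => Finset.sum_nonneg fun w _ => conn_mul_mul_nonneg G p x u w]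
  unfold triangle
  calc ∑ u ∈ B, ENNReal.ofReal (∑ w ∈ B, conn G p x u * conn G p u w * conn G p w x)
      = ∑ u ∈ B, ∑ w ∈ B, ENNReal.ofReal (conn G p x u * conn G p u w * conn G p w x) :=
        Finset.sum_congr rfl fun u _ => ENNReal.ofReal_sum_of_nonneg fun w _ => conn_mul_mul_nonneg G p x u w
    _ ≤ ∑ u ∈ B, ∑' w, ENNReal.ofReal (conn G p x u * conn G p u w * conn G p w x) := Finset.sum_le_sum fun u _ => ENNReal.sum_le_tsum B
    _ ≤ ∑' u, ∑' w, ENNReal.ofReal (conn G p x u * conn G p u w * conn G p w x) := ENNReal.sum_le_tsum B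

omit [G.LocallyFinite] in
/-- `(T_B³)(x, x) ≤ ∇_p(x)` on every window. [folklore] -/
theorem connMatrix_cube_diag_le_triangle (p : unitInterval) (B : Finset V) (x : ↥B) (hfin : triangle G (x : V) p ≠ ⊤) :
    ((Matrix.of fun a b : ↥B => conn G p (a : V) (b : V)) ^ 3) x x ≤ (triangle G (x : V) p).toReal := by
  rw [connMatrix_cube_apply]
  exact sum_sum_conn_le_triangle G p B (x : V) hfin

/-! ## §3 `A_p ≤ ∇_p²` -/

/-- `A_p(v) ≤ b` as soon as every ball restriction satisfies `ofReal A^{(S)}(v) ≤ b`. [folklore] -/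
theorem diagA_le_of_forall_ball (hconn : G.Connected) (v : V) (p : unitInterval) {b : ℝ≥0∞}
    (h : ∀ S : ℕ, ENNReal.ofReal (∑ q ∈ DCTQ.ball G v S ×ˢ (DCTQ.ball G v S ×ˢ (DCTQ.ball G v S ×ˢ DCTQ.ball G v S)), summandA G p v q) ≤ b) :
    diagA G v p ≤ b := by
  unfold diagA
  rw [ENNReal.tsum_eq_iSup_sum]
  refine iSup_le fun F => ?_
  obtain ⟨S, hS⟩ := DCTQ.exists_subset_ball hconn v
    (F.image (fun q => q.1) ∪ F.image (fun q => q.2.1) ∪ F.image (fun q => q.2.2.1) ∪ F.image (fun q => q.2.2.2))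
  have hF : F ⊆ DCTQ.ball G v S ×ˢ (DCTQ.ball G v S ×ˢ (DCTQ.ball G v S ×ˢ DCTQ.ball G v S)) := by
    intro q hq
    simp only [Finset.mem_product]
    refine ⟨hS ?_, hS ?_, hS ?_, hS ?_⟩
    · exact Finset.mem_union_left _ (Finset.mem_union_left _ (Finset.mem_union_left _ (Finset.mem_image_of_mem _ hq)))
    · exact Finset.mem_union_left _ (Finset.mem_union_left _ (Finset.mem_union_right _ (Finset.mem_image_of_mem _ hq)))
    · exact Finset.mem_union_left _ (Finset.mem_union_right _ (Finset.mem_image_of_mem _ hq))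
    · exact Finset.mem_union_right _ (Finset.mem_image_of_mem _ hq)
  calc ∑ q ∈ F, ENNReal.ofReal (summandA G p v q)
      ≤ ∑ q ∈ DCTQ.ball G v S ×ˢ (DCTQ.ball G v S ×ˢ (DCTQ.ball G v S ×ˢ DCTQ.ball G v S)), ENNReal.ofReal (summandA G p v q) :=
        Finset.sum_le_sum_of_subset hF
    _ = ENNReal.ofReal (∑ q ∈ DCTQ.ball G v S ×ˢ (DCTQ.ball G v S ×ˢ (DCTQ.ball G v S ×ˢ DCTQ.ball G v S)), summandA G p v q) :=
        (ENNReal.ofReal_sum_of_nonneg fun q _ => summandA_nonneg G p v q).symm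
    _ ≤ b := h S

omit [G.LocallyFinite] in
/-- **Window bound for `A`**: if the triangle diagram is the same finite number `∇` at every vertex, then on every window `B ∋ x`,
`Σ_{q∈B⁴} summandA(x, q) ≤ ∇²` — `(T_B³)(x,y) ≤ ∇` by positive semidefiniteness, then a partial triangle sum. [cite: Hutchcroft2022Triangle, Lemma 3.3] -/
theorem sum_summandA_window_le [Countable V] (p : unitInterval) (B : Finset V) (x : ↥B) (htri : ∀ z : V, triangle G z p = triangle G (x : V) p)
    (hfin : triangle G (x : V) p ≠ ⊤) :
    ∑ q ∈ B ×ˢ (B ×ˢ (B ×ˢ B)), summandA G p (x : V) q ≤ (triangle G (x : V) p).toReal ^ 2 := by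
  set P : Matrix ↥B ↥B ℝ := Matrix.of fun a b : ↥B => conn G p (a : V) (b : V) with hP
  have hP3 : (P ^ 3).PosSemidef := (posSemidef_connMatrix G p B).pow 3
  set D : ℝ := (triangle G (x : V) p).toReal with hD
  have hD0 : 0 ≤ D := ENNReal.toReal_nonneg
  -- every diagonal entry of `T_B³` is `≤ ∇`
  have hdiag : ∀ y : ↥B, (P ^ 3) y y ≤ D := fun y => by
    have h := connMatrix_cube_diag_le_triangle G p B y (by rw [htri]; exact hfin)
    rwa [htri] at h
  have hoff : ∀ y : ↥B, (P ^ 3) x y ≤ D := fun y => by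
    have h := posSemidef_apply_le_half hP3 x y
    linarith [hdiag x, hdiag y]
  -- reorganise the window sum: `Σ_{(y,z,u,w)} = Σ_{y,z} τ(x,y)(τ(x,z)τ(z,y)) · (T_B³)(x,y)`
  have hre : ∑ q ∈ B ×ˢ (B ×ˢ (B ×ˢ B)), summandA G p (x : V) q =
      ∑ y : ↥B, ∑ z ∈ B, conn G p (x : V) (y : V) * (conn G p (x : V) z * conn G p z (y : V)) * (P ^ 3) x y := by
    rw [Finset.sum_product, ← Finset.sum_coe_sort B]
    refine Finset.sum_congr rfl fun y _ => ?_
    rw [Finset.sum_product]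
    refine Finset.sum_congr rfl fun z _ => ?_
    rw [Finset.sum_product, connMatrix_cube_apply, Finset.mul_sum]
    refine Finset.sum_congr rfl fun u _ => ?_
    rw [Finset.mul_sum]
    refine Finset.sum_congr rfl fun w _ => ?_
    simp only [summandA]
  rw [hre]
  calc ∑ y : ↥B, ∑ z ∈ B, conn G p (x : V) (y : V) * (conn G p (x : V) z * conn G p z (y : V)) * (P ^ 3) x y
      ≤ ∑ y : ↥B, ∑ z ∈ B, conn G p (x : V) (y : V) * (conn G p (x : V) z * conn G p z (y : V)) * D :=
        Finset.sum_le_sum fun y _ => Finset.sum_le_sum fun z _ =>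
          mul_le_mul_of_nonneg_left (hoff y) (mul_nonneg (conn_nonneg G p _ _) (mul_nonneg (conn_nonneg G p _ _) (conn_nonneg G p _ _)))
    _ = D * ∑ y ∈ B, ∑ z ∈ B, conn G p (x : V) z * conn G p z y * conn G p y (x : V) := by
        rw [Finset.mul_sum, ← Finset.sum_coe_sort B]
        refine Finset.sum_congr rfl fun y _ => ?_
        rw [Finset.mul_sum]
        refine Finset.sum_congr rfl fun z _ => ?_
        rw [conn_comm G p (x : V) (y : V)]
        ring
    _ ≤ D * D := by
        refine mul_le_mul_of_nonneg_left ?_ hD0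
        rw [Finset.sum_comm]
        exact sum_sum_conn_le_triangle G p B (x : V) hfin
    _ = D ^ 2 := (sq D).symm

/-- **Hutchcroft's `A_p ≤ ∇_p²` on vertex-transitive graphs** (Prop. 1.7, second inequality / Lemma 3.3), for EVERY `p`: connected, vertex-transitive, locally finite
⇒ `diagA G v p ≤ (triangle G v p)²`. [cite: Hutchcroft2022Triangle, Prop. 1.7, Lemma 3.3] -/
theorem diagA_le_triangle_sq (htr : IsGraphTransitive G) (hconn : G.Connected) (v : V) (p : unitInterval) :
    diagA G v p ≤ triangle G v p ^ 2 := by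
  haveI : Countable V := countable_of_connected_of_locallyFinite G hconn v
  by_cases htop : triangle G v p = ⊤
  · rw [htop, ENNReal.top_pow two_ne_zero]
    exact le_top
  have htri : ∀ z : V, triangle G z p = triangle G v p := fun z => by
    obtain ⟨γ, hγ⟩ := htr v z
    rw [← hγ, triangle_iso]
  refine diagA_le_of_forall_ball G hconn v p fun S => ?_
  have hv : v ∈ DCTQ.ball G v S := DCTQ.mem_ball_self v S
  have h := sum_summandA_window_le G p (DCTQ.ball G v S) ⟨v, hv⟩ (fun z => htri z) htop
  calc ENNReal.ofReal (∑ q ∈ DCTQ.ball G v S ×ˢ (DCTQ.ball G v S ×ˢ (DCTQ.ball G v S ×ˢ DCTQ.ball G v S)), summandA G p v q)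
      ≤ ENNReal.ofReal ((triangle G v p).toReal ^ 2) := ENNReal.ofReal_le_ofReal h
    _ = triangle G v p ^ 2 := by rw [ENNReal.ofReal_pow ENNReal.toReal_nonneg, ENNReal.ofReal_toReal htop]

/-- **Prop. 1.7 combined: `B_p ≤ ∇_p²`** on connected vertex-transitive graphs of subexponential growth, every `p`. [cite: Hutchcroft2022Triangle, Prop. 1.7] -/
theorem diagB_le_triangle_sq (htr : IsGraphTransitive G) (hconn : G.Connected) (hgr : ¬ HasExponentialGrowth G) (v : V) (p : unitInterval) :
    diagB G v p ≤ triangle G v p ^ 2 :=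
  (diagB_le_diagA G htr hconn hgr v p).trans (diagA_le_triangle_sq G htr hconn v p)

end NcHaraSlade

end Grigorchuk

end Summit.CriticalPhenomena.PercolationContinuityZ3.Theorems.Transplant

end
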